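import Literature.AlgebraicGeometry.Frobenioids.Cor411Padic
import Literature.AlgebraicGeometry.Frobenioids.PadicFieldwiseSaturatedPrelim
import Literature.AlgebraicGeometry.Frobenioids.PadicFrobenioidDatumLemmas
import Literature.AlgebraicGeometry.Frobenioids.PadicFrobenioidPerfection
import Literature.AlgebraicGeometry.Frobenioids.PadicFrobenioidCdashHomImage
import Literature.AnabelianGeometry.EtaleTheta.Discharge.Sec5Prop53
import HarnessLib

/-!
# Frobenioids II, Example 1.1 / Theorem 1.2 + Frobenioids I, Corollary 4.11 (iv): transport of `log(p)`-divisors along a self-equivalence of a `p`-adic Frobenioid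

Mochizuki, *The geometry of Frobenioids II*, Kyushu J. Math. **62** (2008) 401–460, §1, Example 1.1 (i)(ii)
pp. 7–8 ("`ord(O_K^⊳) := O_K^⊳/O_K^×` (`≅ ℤ_{≥0}`)", "`B := B₀|_D ×_{Φ₀^gp|_D} Φ^gp`") and Theorem 1.2 (i) p. 9 ("`End_D(A_D)`
acts trivially on `Φ(A_D)`") [cite: MochizukiFrdII2008, Ex 1.1 (ii) p.8] [cite: MochizukiFrdII2008, Thm 1.2 (i) p.9];
Mochizuki, *The geometry of Frobenioids I*, Kyushu J. Math. **62** (2008), Corollary 4.11 (iv) p. 92 ("the functor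
`C → F_Φ` may be reconstructed category-theoretically": `Ψ^Base`, `Ψ^Φ`, compatibility with `Div`)
[cite: MochizukiFrdI2008, Cor. 4.11 (iv) p.92]. Consumed by [IUTchI] Ex. 3.3 (iii) (d) ("[cf. [FrdI], Corollary 4.11,
(iii); [FrdII], Theorem 1.2, (i)]").

PROOF-ONLY file (abc-iut cell, seat abc-iut-L1-t4, «STEP-C-L1», L1-lead R134 (1)), 0 definitions. For a `p`-adic
Frobenioid `C` (datum `d`) and a self-equivalence `Ψ` equipped with its [FrdI] Cor. 4.11 (iv) data `Ψ^Base`,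
`E = Ψ^Φ`, `η` (abc-iut-w4-d109's `PadicFrd.exists_cor411iv_data_padic`, over SLIM bases of FSM-type), this file reduces
"`Ψ` preserves the morphisms whose zero divisor lies in `ℕ · log(p)`" — the input `hmor` of the reconstructibility
socket for [IUTchI] Ex. 3.3 (iii) (d) — to the RAMIFICATION-INDEX RIGIDITY of the induced base equivalence:
* §1 INTEGRAL CLASSES: `Datum.exists_ιHom_div_eq_of_endo` — an endomorphism `ψ` of `(A, α)` with `deg_Fr(ψ) = 1` has
  `Div(ψ) = ord(a)` for some `a ∈ O_{K_A}^⊳` (relation (d) of [FrdI] Thm. 5.2 (i) and "`End_D(A)` acts trivially", so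
  `[Div ψ] = Div_B(u_ψ) = Div₀(u_ψ|_{K^×}) ∈ ord(K_A^×) = ℤ · ord(π)`, and sharpness); conversely
  `Datum.exists_linear_endo_of_ιHom_eq` — every class `ord(a) ∈ Φ(A)` is `Div` of a base-identity linear
  endomorphism `(1, id, ord(a), u)`.
* §2 `mulEquiv_eq_of_isZMonoprime` — isomorphisms out of `ord(O_K^⊳) ≅ ℤ_{≥0}` are unique (over the tree's
  `FrobenioidThetaDivisors.mulEquiv_multiplicative_nat_eq_refl`: `Aut(ℤ_{≥0}) = 1`).
* §3 TRANSPORT `Datum.ιHom_div_map_eq_primGen_pow_of_data`: the composite `T := η_X^* ∘ E` carries the integral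
  classes of `Φ(Base X)` BIJECTIVELY onto those of `Φ(Base ΨX)` (into: §1 → `Ψ` → Frobenius degrees preserved → §1;
  onto: fullness of `Ψ`), hence induces an isomorphism `ord(O^⊳_{K_A}) ⥲ ord(O^⊳_{K_{A'}})`, which by §2 is THE
  isomorphism `ι` of the hypothesis (γ) "`ι(ord p) = ord p`" — so `T(log p_A) = log p_{A'}` and
  **`ι(Div φ) = log(p)^n ⇒ ι(Div Ψφ) = log(p)^n`**; `Datum.ιHom_div_map_eq_primGen_pow` — the same over a slim FSM-type
  base with the Cor. 4.11 (iv) data supplied by `exists_cor411iv_data_padic`; `Datum.perf_exists_ιHom_eq` — the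
  integrality hypothesis (INT) "`ord(O^⊳) ⊆ Φ`" holds for the perfection datum of [IUTchI] Ex. 3.3.
The hypothesis (γ) (for every `X`, an isomorphism of value monoids `ord(O^⊳_{K_{Base X}}) ≅ ord(O^⊳_{K_{Base ΨX}})` fixing
`ord(p)`, i.e. equal ramification indices over `ℚ_p`) is the anabelian input ([AbsAnab] Prop. 1.2.1 (v)) and is NOT
proved here. No statement of either paper is strengthened; nothing here bears on [IUTchIII].
-/

namespace Literature.AlgebraicGeometry.Frobenioids

open CategoryTheory Opposite Function

universe v u

/-! ### §2 Isomorphisms out of `ℤ_{≥0}` are unique -/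

/-- **Isomorphisms out of a `ℤ`-monoprime monoid are unique**: two isomorphisms `τ, ι : M ⥲ N` with `M ≅ ℤ_{≥0}`
coincide. [cite: MochizukiFrdI2008, §0 p.10] -/
theorem mulEquiv_eq_of_isZMonoprime {M N : Type*} [CommMonoid M] [CommMonoid N] (hM : IsZMonoprime M)
    (τ ι : M ≃* N) : τ = ι := by
  obtain ⟨⟨e⟩⟩ := hM
  have h := Literature.AnabelianGeometry.EtaleTheta.FrobenioidThetaDivisors.mulEquiv_multiplicative_nat_eq_refl
    (e.symm.trans ((τ.trans ι.symm).trans e))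
  ext x
  have hx := MulEquiv.congr_fun h (e x)
  simp only [MulEquiv.trans_apply, MulEquiv.symm_apply_apply, MulEquiv.refl_apply] at hx
  have hx' : ι.symm (τ x) = x := e.injective hx
  simpa using congrArg ι hx'

namespace PadicFrd

namespace Datum

variable {D : Type u} [Category.{v} D] {p : ℕ} [Fact p.Prime] (d : Datum D p)

/-! ### §1 Integral classes: divisors of linear endomorphisms -/

/-- **`Div` of a linear endomorphism is integral**: an endomorphism `ψ` of `(A, α)` with `deg_Fr(ψ) = 1` has
`ι(Div ψ) = a ⊗ 1` for some `a ∈ ord(O_{K_A}^⊳)` — `End_D(A)` acts trivially on `Φ(A)^gp` (Thm. 1.2 (i)), so relation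
(d) of [FrdI] Thm. 5.2 (i) reads `[Div ψ] = Div_B(u_ψ) = Div₀(u_ψ|_{K^×}) ∈ ord(K_A^×) = ℤ · ord(π_A)`, and the exponent is
`≥ 0` by sharpness. [cite: MochizukiFrdII2008, Thm 1.2 (i) p.9] -/
theorem exists_ιHom_div_eq_of_endo (W : d.frobenioid) (ψ : W ⟶ W) (hψ : ModelFrobenioid.degFr ψ = 1) :
    ∃ a : OrdInt (d.fld W.base), d.ιHom W.base (ModelFrobenioid.div ψ) = Realification.of _ a := by
  haveI := isCancelMul_realification (OrdInt (d.fld W.base))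
  have hrel := ModelFrobenioid.rel ψ
  rw [hψ, PNat.one_coe, pow_one, d.pullGp_endo] at hrel
  have h1 : Algebra.GrothendieckGroup.of (ModelFrobenioid.div ψ) =
      Frobenioids.divB d.Φ d.B d.divB (op W.base) (ModelFrobenioid.unit ψ) := mul_left_cancel hrel
  have h2 : d.phiGp W.base (ModelFrobenioid.div ψ) =
      divZeroHom (d.fld W.base) (d.resK W.base (ModelFrobenioid.unit ψ)) := by
    rw [phiGp_eq_monGp_map_of, h1, divZeroHom_resK]
  obtain ⟨π, hπ1, hπ⟩ := d.exists_uniformizer W.base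
  obtain ⟨k, hk⟩ := d.exists_zpow_eq_of_mem_ordUnitsSubgroup W.base hπ
    (h2 ▸ d.divZeroHom_mem_ordUnitsSubgroup W.base _)
  rcases le_or_gt 0 k with hk0 | hk0
  · refine ⟨Associates.mk π ^ k.toNat, ?_⟩
    apply Algebra.GrothendieckGroup.of_injective (M := Realification (OrdInt (d.fld W.base)))
    change d.phiGp W.base (ModelFrobenioid.div ψ) = d.ordIntGp W.base (Associates.mk π ^ k.toNat)
    rw [hk, map_pow, ← zpow_natCast, Int.toNat_of_nonneg hk0]
  · exfalso
    have h3 : d.phiGp W.base (ModelFrobenioid.div ψ) * d.ordIntGp W.base (Associates.mk π ^ (-k).toNat) = 1 := by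
      rw [map_pow, hk, ← zpow_natCast, Int.toNat_of_nonneg (by omega), ← zpow_add, add_neg_cancel, zpow_zero]
    have h4 := (d.eq_one_of_phiGp_mul_ordIntGp_eq_one W.base _ _ h3).2
    have h5 : IsUnit (Associates.mk π) := IsUnit.of_pow_eq_one h4 (by omega)
    exact hπ1 (Associates.isUnit_iff_eq_one _ |>.mp h5)

/-- **Every integral class is `Div` of a base-identity linear endomorphism**: for `c ∈ Φ(A)` with `ι c = a ⊗ 1`,
`a ∈ ord(O_{K_A}^⊳)`, and any object `(A, α)`, the arrow `(1, id, c, u) : (A, α) → (A, α)` with `u ∈ B(A)` over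
`(ã, [c])`, `ã ∈ O_{K_A}^⊳` a representative of `a` (`B(A) = K_A^× ×_{Φ₀^gp} Φ^gp`). [cite: MochizukiFrdII2008, Ex 1.1 (ii) p.8] -/
theorem exists_linear_endo_of_ιHom_eq (X : d.frobenioid) (c : d.Φ.obj (op X.base)) (a : OrdInt (d.fld X.base))
    (hc : d.ιHom X.base c = Realification.of _ a) :
    ∃ φ : X ⟶ X, ModelFrobenioid.degFr φ = 1 ∧ ModelFrobenioid.baseMap φ = 𝟙 X.base ∧ ModelFrobenioid.div φ = c := by
  obtain ⟨a', rfl⟩ := Associates.mk_surjective a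
  obtain ⟨u, -, hu⟩ := d.exists_B_of_compat (op X.base) (intNonzeroToUnits (d.fld X.base) a')
    (Algebra.GrothendieckGroup.of c) (by
      rw [divZeroHom_intNonzeroToUnits, MonGp.map_of]
      exact (congrArg Algebra.GrothendieckGroup.of hc).symm)
  refine ⟨ModelFrobenioid.mkHom X X 1 (𝟙 _) c u ?_, rfl, rfl, rfl⟩
  rw [PNat.one_coe, pow_one, pullGp_id, hu]

/-! ### §3 Transport of `log(p)`-divisors along a self-equivalence with Cor. 4.11 (iv) data -/

/-- **Transport of `log(p)`-divisors — core form over explicit [FrdI] Cor. 4.11 (iv) data.** Let `Ψ` be a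
self-equivalence of the `p`-adic Frobenioid `C` together with `Ψ^Base`, monoid isomorphisms
`E_A : Φ(A) ⥲ Φ(Ψ^Base A)`, isomorphisms `η_X : Base(ΨX) ⥲ Ψ^Base(Base X)` such that `Ψ` preserves Frobenius degrees
and `Div(Ψφ) = η_X^* E(Div φ)` (Cor. 4.11 (iv)). Assume (INT) `ord(O^⊳_{K_A}) ⊗ 1 ⊆ Φ(A)` for all `A` and
(γ) for every `X` an isomorphism `ord(O^⊳_{K_{Base X}}) ⥲ ord(O^⊳_{K_{Base ΨX}})` fixing `ord(p)`. Then
`ι(Div φ) = log(p)^n` implies `ι(Div Ψφ) = log(p)^n`: the composite `η_X^* ∘ E` maps integral classes bijectively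
onto integral classes (§1, Frobenius degrees, FULLNESS of `Ψ`), so induces THE isomorphism of (γ) (§2) and fixes
`log(p)`. [cite: MochizukiFrdI2008, Cor. 4.11 (iv) p.92] -/
theorem ιHom_div_map_eq_primGen_pow_of_data (Ψ : d.frobenioid ≌ d.frobenioid) (ΨBase : D ⥤ D)
    (E : ∀ A : D, d.Φ.obj (op A) ≃* d.Φ.obj (op (ΨBase.obj A)))
    (ηapp : ∀ X : d.frobenioid, (Ψ.functor.obj X).base ⟶ ΨBase.obj X.base) (hη : ∀ X, IsIso (ηapp X))
    (hdeg : ∀ {X Y : d.frobenioid} (φ : X ⟶ Y),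
      ModelFrobenioid.degFr (Ψ.functor.map φ) = ModelFrobenioid.degFr φ)
    (hdiv : ∀ {X Y : d.frobenioid} (φ : X ⟶ Y),
      ModelFrobenioid.div (Ψ.functor.map φ) = Frobenioids.pull d.Φ (ηapp X) (E X.base (ModelFrobenioid.div φ)))
    (hint : ∀ (A : D) (a : OrdInt (d.fld A)), ∃ c : d.Φ.obj (op A), d.ιHom A c = Realification.of _ a)
    (hram : ∀ X : d.frobenioid, ∃ ι : OrdInt (d.fld X.base) ≃* OrdInt (d.fld (Ψ.functor.obj X).base),
      ι (Associates.mk ⟨((p : ℕ) : d.fld X.base), (d.base.obj X.base).p_mem⟩) =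
        Associates.mk ⟨((p : ℕ) : d.fld (Ψ.functor.obj X).base), (d.base.obj (Ψ.functor.obj X).base).p_mem⟩)
    {X Y : d.frobenioid} (φ : X ⟶ Y) (n : ℕ)
    (hφ : d.ιHom X.base (ModelFrobenioid.div φ) = primGen d.base X.base ^ n) :
    d.ιHom (Ψ.functor.obj X).base (ModelFrobenioid.div (Ψ.functor.map φ)) =
      primGen d.base (Ψ.functor.obj X).base ^ n := by
  classical
  -- notation
  haveI := hη X
  let X' := Ψ.functor.obj X
  let T : d.Φ.obj (op X.base) →* d.Φ.obj (op X'.base) :=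
    (Frobenioids.pull d.Φ (ηapp X)).comp (E X.base).toMonoidHom
  have hT : ∀ {Z : d.frobenioid} (χ : X ⟶ Z), ModelFrobenioid.div (Ψ.functor.map χ) = T (ModelFrobenioid.div χ) :=
    fun χ => hdiv χ
  have hTinj : Injective T := by
    haveI : IsIso (d.Φ.map (ηapp X).op) := inferInstance
    exact (ModelFrobenioid.injective_hom_of_isIso_commMonCat (d.Φ.map (ηapp X).op)).comp (E X.base).injective
  have hιA := d.ιHom_injective X.base
  have hιA' := d.ιHom_injective X'.base
  have hofA := Realification.of_injective (d.isMonoprime_ordInt_fld X.base)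
  have hofA' := Realification.of_injective (d.isMonoprime_ordInt_fld X'.base)
  -- (S3) `T` maps integral classes to integral classes
  have hTint : ∀ (c : d.Φ.obj (op X.base)) (a : OrdInt (d.fld X.base)), d.ιHom X.base c = Realification.of _ a →
      ∃ a' : OrdInt (d.fld X'.base), d.ιHom X'.base (T c) = Realification.of _ a' := by
    intro c a hc
    obtain ⟨χ, hχd, -, hχc⟩ := d.exists_linear_endo_of_ιHom_eq X c a hc
    obtain ⟨a', ha'⟩ := d.exists_ιHom_div_eq_of_endo X' (Ψ.functor.map χ) (by rw [hdeg, hχd])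
    exact ⟨a', by rw [← hχc, ← hT]; exact ha'⟩
  -- (S4) ... surjectively, by fullness of `Ψ`
  have hTsurj : ∀ a' : OrdInt (d.fld X'.base), ∃ (c : d.Φ.obj (op X.base)) (a : OrdInt (d.fld X.base)),
      d.ιHom X.base c = Realification.of _ a ∧ d.ιHom X'.base (T c) = Realification.of _ a' := by
    intro a'
    obtain ⟨c', hc'⟩ := hint X'.base a'
    obtain ⟨ψ, hψd, -, hψc⟩ := d.exists_linear_endo_of_ιHom_eq X' c' a' hc'
    let χ : X ⟶ X := Ψ.functor.preimage ψ
    have hχ : Ψ.functor.map χ = ψ := Ψ.functor.map_preimage ψ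
    have hχd : ModelFrobenioid.degFr χ = 1 := by rw [← hdeg, hχ, hψd]
    obtain ⟨a, ha⟩ := d.exists_ιHom_div_eq_of_endo X χ hχd
    refine ⟨ModelFrobenioid.div χ, a, ha, ?_⟩
    rw [← hT, hχ, hψc, hc']
  -- the induced map `g : ord(O^⊳_A) → ord(O^⊳_{A'})`
  have hca : ∀ a : OrdInt (d.fld X.base), ∃ c : d.Φ.obj (op X.base), d.ιHom X.base c = Realification.of _ a :=
    hint X.base
  choose ca hca' using hca
  have hga : ∀ a : OrdInt (d.fld X.base), ∃ a' : OrdInt (d.fld X'.base),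
      d.ιHom X'.base (T (ca a)) = Realification.of _ a' := fun a => hTint (ca a) a (hca' a)
  choose g hg using hga
  have hca_one : ca 1 = 1 := hιA (by rw [hca', map_one, map_one])
  have hca_mul : ∀ a b, ca (a * b) = ca a * ca b := fun a b =>
    hιA (by rw [hca', map_mul, map_mul, hca', hca'])
  let gHom : OrdInt (d.fld X.base) →* OrdInt (d.fld X'.base) :=
    { toFun := g
      map_one' := hofA' (by rw [← hg, hca_one, map_one, map_one, map_one])
      map_mul' := fun a b => hofA' (by rw [← hg, hca_mul, map_mul, map_mul, map_mul, hg, hg]) }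
  have hg_inj : Injective gHom := by
    intro a b hab
    have h1 : d.ιHom X'.base (T (ca a)) = d.ιHom X'.base (T (ca b)) := by
      change g a = g b at hab
      rw [hg, hg, hab]
    have h2 : ca a = ca b := hTinj (hιA' h1)
    exact hofA (by rw [← hca', ← hca', h2])
  have hg_surj : Surjective gHom := by
    intro a'
    obtain ⟨c, a, hc, hTc⟩ := hTsurj a'
    refine ⟨a, hofA' ?_⟩
    have h1 : ca a = c := hιA (by rw [hca', hc])
    change Realification.of _ (g a) = _
    rw [← hg, h1, hTc]
  let τ : OrdInt (d.fld X.base) ≃* OrdInt (d.fld X'.base) := MulEquiv.ofBijective gHom ⟨hg_inj, hg_surj⟩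
  -- by §2, `τ` is THE isomorphism of (γ): it fixes `ord(p)`
  obtain ⟨ι, hι⟩ := hram X
  have hτι : τ = ι := mulEquiv_eq_of_isZMonoprime (d.isZMonoprime_ordInt_fld X.base) τ ι
  set aP : OrdInt (d.fld X.base) := Associates.mk ⟨((p : ℕ) : d.fld X.base), (d.base.obj X.base).p_mem⟩ with haP
  set aP' : OrdInt (d.fld X'.base) :=
    Associates.mk ⟨((p : ℕ) : d.fld X'.base), (d.base.obj X'.base).p_mem⟩ with haP'
  have hgP : g aP = aP' := by
    have h : τ aP = aP' := by rw [hτι]; exact hι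
    exact h
  -- `T (log p) = log p`
  have hTlogp : d.ιHom X'.base (T (ca aP)) = primGen d.base X'.base := by
    rw [hg, hgP]
    rfl
  -- conclusion
  have hdivφ : ModelFrobenioid.div φ = ca aP ^ n := hιA (by rw [hφ, map_pow, hca']; rfl)
  rw [hT, hdivφ, map_pow, map_pow, hTlogp]

/-- **Transport of `log(p)`-divisors along a self-equivalence of a `p`-adic Frobenioid over a SLIM base of FSM-type**:
with the [FrdI] Cor. 4.11 (iv) data of `Ψ` supplied by `PadicFrd.exists_cor411iv_data_padic` (abc-iut-w4-d109), under
(INT) and the ramification hypothesis (γ), `ι(Div φ) = log(p)^n ⇒ ι(Div Ψφ) = log(p)^n`.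
[cite: MochizukiFrdI2008, Cor. 4.11 (iv) p.92] -/
theorem ιHom_div_map_eq_primGen_pow (hD : IsOfFSMType D) (hsl : IsSlim D) (Ψ : d.frobenioid ≌ d.frobenioid)
    (hint : ∀ (A : D) (a : OrdInt (d.fld A)), ∃ c : d.Φ.obj (op A), d.ιHom A c = Realification.of _ a)
    (hram : ∀ X : d.frobenioid, ∃ ι : OrdInt (d.fld X.base) ≃* OrdInt (d.fld (Ψ.functor.obj X).base),
      ι (Associates.mk ⟨((p : ℕ) : d.fld X.base), (d.base.obj X.base).p_mem⟩) =
        Associates.mk ⟨((p : ℕ) : d.fld (Ψ.functor.obj X).base), (d.base.obj (Ψ.functor.obj X).base).p_mem⟩)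
    {X Y : d.frobenioid} (φ : X ⟶ Y) (n : ℕ)
    (hφ : d.ιHom X.base (ModelFrobenioid.div φ) = primGen d.base X.base ^ n) :
    d.ιHom (Ψ.functor.obj X).base (ModelFrobenioid.div (Ψ.functor.map φ)) =
      primGen d.base (Ψ.functor.obj X).base ^ n := by
  obtain ⟨ΨBase, Ecor, η, -, hdeg, hdiv, -⟩ := PadicFrd.exists_cor411iv_data_padic d d hD hD hsl hsl Ψ
  exact d.ιHom_div_map_eq_primGen_pow_of_data Ψ ΨBase (fun A => Ecor.iso A) (fun X => η.hom.app X)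
    (fun X => (inferInstance : IsIso (η.hom.app X))) (fun φ => hdeg φ) (fun φ => hdiv φ) hint hram φ n hφ

/-- The same in `Submonoid.powers` form (the shape of the input `hmor` of the reconstructibility socket for
[IUTchI] Ex. 3.3 (iii) (d): "`Ψ` preserves the morphisms with `Div ∈ ℕ · log(p)`").
[cite: MochizukiFrdI2008, Cor. 4.11 (iv) p.92] -/
theorem ιHom_div_map_mem_powers_primGen (hD : IsOfFSMType D) (hsl : IsSlim D) (Ψ : d.frobenioid ≌ d.frobenioid)
    (hint : ∀ (A : D) (a : OrdInt (d.fld A)), ∃ c : d.Φ.obj (op A), d.ιHom A c = Realification.of _ a)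
    (hram : ∀ X : d.frobenioid, ∃ ι : OrdInt (d.fld X.base) ≃* OrdInt (d.fld (Ψ.functor.obj X).base),
      ι (Associates.mk ⟨((p : ℕ) : d.fld X.base), (d.base.obj X.base).p_mem⟩) =
        Associates.mk ⟨((p : ℕ) : d.fld (Ψ.functor.obj X).base), (d.base.obj (Ψ.functor.obj X).base).p_mem⟩)
    {X Y : d.frobenioid} (φ : X ⟶ Y)
    (hφ : d.ιHom X.base (ModelFrobenioid.div φ) ∈ Submonoid.powers (primGen d.base X.base)) :
    d.ιHom (Ψ.functor.obj X).base (ModelFrobenioid.div (Ψ.functor.map φ)) ∈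
      Submonoid.powers (primGen d.base (Ψ.functor.obj X).base) := by
  obtain ⟨n, hn⟩ := (Submonoid.mem_powers_iff _ _).mp hφ
  exact (Submonoid.mem_powers_iff _ _).mpr ⟨n, (d.ιHom_div_map_eq_primGen_pow hD hsl Ψ hint hram φ n hn.symm).symm⟩

end Datum

/-! ### (INT) for the perfection datum: `ord(O^⊳) ⊆ ord(O^⊳)^pf = Φ_{C_v}` -/

/-- The integrality hypothesis (INT) of the transport theorem holds for the perfection datum `Φ = ord(O^⊳)^pf`
([IUTchI] Ex. 3.3 (i) `Φ_{C_v}`): every `a ⊗ 1`, `a ∈ ord(O_{K_A}^⊳)`, lies in `Φ(A)`. [cite: MochizukiFrdII2008, Ex 1.1 (ii) p.8] -/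
theorem Datum.perf_exists_ιHom_eq {D : Type u} [Category.{v} D] {p : ℕ} [Fact p.Prime] (base : D ⥤ PadicFld.{u} p)
    (hloc : ∀ A : D, (base.obj A).IsPadicLocal) (hc : IsConnected D) (he : IsTotallyEpimorphic D) (A : D)
    (a : OrdInt (base.obj A).K) :
    ∃ c : (Datum.perf base hloc hc he).Φ.obj (op A),
      (Datum.perf base hloc hc he).ιHom A c = Realification.of _ a :=
  ⟨⟨Realification.of _ a, Realification.of_mem_perf a⟩, rfl⟩

end PadicFrd

end Literature.AlgebraicGeometry.Frobenioids
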